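import Literature.NumberTheory.EllipticCurves.BinaryQuarticLocalSolubility
import Mathlib.FieldTheory.IsAlgClosed.Basic
import Mathlib.Tactic.ComputeDegree
import HarnessLib

/-!
# The discriminant of a binary quartic form: `∂Δ/∂e`, the root parametrisation, and the
# singular strata `{Δ = ∂Δ/∂e = 0}` (input to Bhargava–Shankar, Thms 2.18, 2.20, 2.21)

Topic `Literature/NumberTheory/EllipticCurves`; companion of `BinaryQuarticForms.lean` (vocabulary
of M. Bhargava, A. Shankar, *Binary quartic forms having bounded invariants, and the boundedness of
the average rank of elliptic curves*, Ann. of Math. (2) 181 (2015) 191–242; theorem numbers below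
are those of the published version = `arXiv:1006.1002v3`, §2.6–2.7).

The uniformity estimate and the square-free sieve of the source (Thms 2.13, 2.18, 2.20, 2.21 of
the published version) rest on three arithmetic facts about the set
`W_p = {f ∈ V_ℤ : p² ∣ Δ(f)}`, all asserted there without proof:

1. (Thm 2.18, from [geosieve]) a form whose discriminant is *strongly* divisible by `p²` reduces
   modulo `p` into `Y(𝔽_p)`, "where `Y` is the codimension 2 subscheme of `V ≅ 𝔸⁵` defined by the
   vanishing of `Δ` and `∂Δ/∂e`";
2. (proof of Thm 2.20) "the derivative of `Δ` with respect to `e` is a nonzero cubic polynomial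
   `∂Δ/∂e` in `e` … there are at most `3` choices for the residue of `e₀ (mod p)` such that `p ∣ Δ`.
   Since `p ∤ ∂Δ/∂e`, each such residue modulo `p` has a unique lift modulo `p²` such that
   `p² ∣ Δ`";
3. (proof of Thm 2.21, citing [BPS, proof of Thm 3.2]) `∫_{f ∈ V_{ℤ_p}, p² ∣ Δ(f)} df ≪ p⁻²`.

This file supplies the *algebra* behind them; the companion
`BinaryQuarticDiscriminantCongruencesProofs.lean` does the counting over `ℤ/p` and `ℤ/p²`
(`#Y(𝔽_p) = O(p³)`, at most `3` residues, unique lifts, `#{f mod p² : p² ∣ Δ(f)} = O(p⁸)`, with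
explicit constants).

## Contents

* `BinaryQuartic.discDerivE f = ∂Δ/∂e` (explicit; `Δ` is the cubic
  `256a³e³ + (−192a²bd − 128a²c² + 144ab²c − 27b⁴)e² + … ` in `e`, `disc_eq_cubic_e`), its
  compatibility with ring maps, and the exact Taylor formula
  `Δ(a,b,c,d,e+h) = Δ + h·∂Δ/∂e + h²·(…)` (`disc_add_e`).
* `BinaryQuartic.ofRoots a r₁ r₂ r₃ r₄ = a ∏ (x − rᵢ y)` (`eval_ofRoots`) and the classical
  identities `Δ = a⁶ ∏_{i<j} (rᵢ − rⱼ)²` (`disc_ofRoots`),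
  `∂Δ/∂e (a(x−ry)²(x−sy)(x−ty)) = −4a⁵(s−r)³(t−r)³(s−t)²` (`discDerivE_ofRoots_double`),
  `I = J = 0` at a triple root, and the two *square-stratum equations*
  `8a²d = b(4ac − b²)`, `64a³e = (4ac − b²)²` satisfied by `a·q(x,y)²`.
* Over an algebraically closed field, a form with `a ≠ 0` is an `ofRoots` (`exists_eq_ofRoots`),
  whence the **structure theorem** `strata_of_disc_eq_zero_of_discDerivE_eq_zero`: if `2 ≠ 0`,
  `a ≠ 0`, `Δ(f) = 0` and `∂Δ/∂e(f) = 0`, then either `I(f) = J(f) = 0` (root of multiplicity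
  `≥ 3`) or the square-stratum equations hold (two double roots) — i.e. off `a = 0` the variety
  `Y = {Δ = ∂Δ/∂e = 0}` is contained in two explicit threefolds, which is the quantitative form of
  "`Y` has codimension `2`" used in the companion file.
* `Fintype (BinaryQuartic R)` for finite `R`, with `card = (card R)⁵`.

## References

* M. Bhargava, A. Shankar, Ann. of Math. (2) 181 (2015) 191–242, §2.6 (Thms 2.18, 2.20) and §2.7
  (Thm 2.21) of the published version (= arXiv:1006.1002v3). [cite: BhargavaShankarAnnals2015, §2.6–2.7 (published numbering)]
* The identities themselves are classical invariant theory of the binary quartic. [folklore]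
-/

noncomputable section

open scoped Classical
open Polynomial

namespace Literature.NumberTheory.EllipticCurves

namespace BinaryQuartic

section CommRing

variable {R S : Type*} [CommRing R] [CommRing S]

/-! ## `∂Δ/∂e` and the Taylor formula in `e` -/

/-- `∂Δ/∂e`, the derivative of the discriminant of `f = a x⁴ + b x³y + c x²y² + d xy³ + e y⁴` with
respect to the last coefficient `e` (Bhargava–Shankar 2015, §2.6: "the derivative of `Δ` with
respect to `e` is a nonzero cubic polynomial `∂Δ/∂e` in `e`"; it cuts out, with `Δ`, the
subscheme `Y` of Thm 2.18). Explicitly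
`768a³e² − 384a²bde − 256a²c²e + 144a²cd² + 288ab²ce − 6ab²d² − 80abc²d + 16ac⁴ − 54b⁴e + 18b³cd − 4b²c³`.
[cite: BhargavaShankarAnnals2015, §2.6, proof of Thm 2.20 (published numbering)] -/
def discDerivE (f : BinaryQuartic R) : R :=
  768 * f.a ^ 3 * f.e ^ 2 - 384 * f.a ^ 2 * f.b * f.d * f.e - 256 * f.a ^ 2 * f.c ^ 2 * f.e
    + 144 * f.a ^ 2 * f.c * f.d ^ 2 + 288 * f.a * f.b ^ 2 * f.c * f.e - 6 * f.a * f.b ^ 2 * f.d ^ 2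
    - 80 * f.a * f.b * f.c ^ 2 * f.d + 16 * f.a * f.c ^ 4 - 54 * f.b ^ 4 * f.e
    + 18 * f.b ^ 3 * f.c * f.d - 4 * f.b ^ 2 * f.c ^ 3

/-- `∂Δ/∂e` commutes with change of ring (elementary). [folklore] -/
@[simp] theorem discDerivE_map (φ : R →+* S) (f : BinaryQuartic R) :
    (f.map φ).discDerivE = φ f.discDerivE := by
  simp only [discDerivE, map, map_add, map_sub, map_mul, map_pow, map_ofNat]

/-- `Δ` as a cubic polynomial in `e`:
`Δ = 256a³·e³ + (−192a²bd − 128a²c² + 144ab²c − 27b⁴)·e² + (144a²cd² − 6ab²d² − 80abc²d + 16ac⁴ +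
18b³cd − 4b²c³)·e + (−27a²d⁴ + 18abcd³ − 4ac³d² − 4b³d³ + b²c²d²)`. [folklore] -/
theorem disc_eq_cubic_e (f : BinaryQuartic R) :
    f.disc = 256 * f.a ^ 3 * f.e ^ 3
      + (-192 * f.a ^ 2 * f.b * f.d - 128 * f.a ^ 2 * f.c ^ 2 + 144 * f.a * f.b ^ 2 * f.c
          - 27 * f.b ^ 4) * f.e ^ 2
      + (144 * f.a ^ 2 * f.c * f.d ^ 2 - 6 * f.a * f.b ^ 2 * f.d ^ 2 - 80 * f.a * f.b * f.c ^ 2 * f.d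
          + 16 * f.a * f.c ^ 4 + 18 * f.b ^ 3 * f.c * f.d - 4 * f.b ^ 2 * f.c ^ 3) * f.e
      + (-27 * f.a ^ 2 * f.d ^ 4 + 18 * f.a * f.b * f.c * f.d ^ 3 - 4 * f.a * f.c ^ 3 * f.d ^ 2
          - 4 * f.b ^ 3 * f.d ^ 3 + f.b ^ 2 * f.c ^ 2 * f.d ^ 2) := by
  simp only [disc]; ring

/-- `∂Δ/∂e` as a quadratic polynomial in `e` (the `e`-derivative of `disc_eq_cubic_e`). [folklore] -/
theorem discDerivE_eq_quadratic_e (f : BinaryQuartic R) :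
    f.discDerivE = 768 * f.a ^ 3 * f.e ^ 2
      + 2 * (-192 * f.a ^ 2 * f.b * f.d - 128 * f.a ^ 2 * f.c ^ 2 + 144 * f.a * f.b ^ 2 * f.c
          - 27 * f.b ^ 4) * f.e
      + (144 * f.a ^ 2 * f.c * f.d ^ 2 - 6 * f.a * f.b ^ 2 * f.d ^ 2 - 80 * f.a * f.b * f.c ^ 2 * f.d
          + 16 * f.a * f.c ^ 4 + 18 * f.b ^ 3 * f.c * f.d - 4 * f.b ^ 2 * f.c ^ 3) := by
  simp only [discDerivE]; ring

/-- **Taylor's formula for `Δ` in the variable `e`** (exact, over any commutative ring):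
`Δ(a,b,c,d,e+h) = Δ(f) + h·∂Δ/∂e(f) + h²·(256a³(3e + h) − 192a²bd − 128a²c² + 144ab²c − 27b⁴)`.
With `h = p·t` this is the computation behind "each such residue modulo `p` has a unique lift
modulo `p²` such that `p² ∣ Δ`" (Bhargava–Shankar 2015, proof of Thm 2.20).
[cite: BhargavaShankarAnnals2015, §2.6, proof of Thm 2.20 (published numbering)] -/
theorem disc_add_e (f : BinaryQuartic R) (h : R) :
    (⟨f.a, f.b, f.c, f.d, f.e + h⟩ : BinaryQuartic R).disc =
      f.disc + h * f.discDerivE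
        + h ^ 2 * (256 * f.a ^ 3 * (3 * f.e + h) - 192 * f.a ^ 2 * f.b * f.d
            - 128 * f.a ^ 2 * f.c ^ 2 + 144 * f.a * f.b ^ 2 * f.c - 27 * f.b ^ 4) := by
  simp only [disc, discDerivE]; ring

/-- At `a = 0` the discriminant is the quadratic
`−27b⁴·e² + (18b³cd − 4b²c³)·e + (b²c²d² − 4b³d³)` in `e`. [folklore] -/
theorem disc_eq_of_a_eq_zero (f : BinaryQuartic R) (ha : f.a = 0) :
    f.disc = -27 * f.b ^ 4 * f.e ^ 2 + (18 * f.b ^ 3 * f.c * f.d - 4 * f.b ^ 2 * f.c ^ 3) * f.e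
      + (f.b ^ 2 * f.c ^ 2 * f.d ^ 2 - 4 * f.b ^ 3 * f.d ^ 3) := by
  simp only [disc, ha]; ring

/-- `12a·J = Q(d) + (72ac − 27b²)·I` with `Q(d) = −324a²·d² + (324abc − 81b³)·d + (27b²c² − 96ac³)`:
on `I = 0` the invariant `J` becomes, after clearing `12a`, a quadratic in `d` with leading
coefficient `−324a²` (used to count the stratum `I = J = 0`). [folklore] -/
theorem twelve_mul_a_mul_J (f : BinaryQuartic R) :
    12 * f.a * f.J = -324 * f.a ^ 2 * f.d ^ 2 + (324 * f.a * f.b * f.c - 81 * f.b ^ 3) * f.d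
      + (27 * f.b ^ 2 * f.c ^ 2 - 96 * f.a * f.c ^ 3) + (72 * f.a * f.c - 27 * f.b ^ 2) * f.I := by
  simp only [I, J]; ring

/-! ## The root parametrisation `a ∏ (x − rᵢ y)` -/

/-- The form `a (x − r₁y)(x − r₂y)(x − r₃y)(x − r₄y)` with leading coefficient `a` and roots
`r₁, …, r₄` (`eval_ofRoots`), written out by Vieta's formulas:
`(a, −a·e₁, a·e₂, −a·e₃, a·e₄)` with `eₖ` the elementary symmetric functions of the roots.
[folklore] -/
def ofRoots (a r₁ r₂ r₃ r₄ : R) : BinaryQuartic R :=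
  ⟨a, -(a * (r₁ + r₂ + r₃ + r₄)),
    a * (r₁ * r₂ + r₁ * r₃ + r₁ * r₄ + r₂ * r₃ + r₂ * r₄ + r₃ * r₄),
    -(a * (r₁ * r₂ * r₃ + r₁ * r₂ * r₄ + r₁ * r₃ * r₄ + r₂ * r₃ * r₄)),
    a * (r₁ * r₂ * r₃ * r₄)⟩

/-- The leading coefficient of `ofRoots a …` is `a` (definitional). [folklore] -/
@[simp] theorem ofRoots_a (a r₁ r₂ r₃ r₄ : R) : (ofRoots a r₁ r₂ r₃ r₄).a = a := rfl

/-- `ofRoots a r₁ r₂ r₃ r₄ = a (x − r₁y)(x − r₂y)(x − r₃y)(x − r₄y)`. [folklore] -/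
theorem eval_ofRoots (a r₁ r₂ r₃ r₄ x y : R) :
    (ofRoots a r₁ r₂ r₃ r₄).eval x y =
      a * (x - r₁ * y) * (x - r₂ * y) * (x - r₃ * y) * (x - r₄ * y) := by
  simp only [eval, ofRoots]; ring

/-- `ofRoots` is symmetric in the roots: transposition of the first two. [folklore] -/
theorem ofRoots_swap₁₂ (a r₁ r₂ r₃ r₄ : R) : ofRoots a r₁ r₂ r₃ r₄ = ofRoots a r₂ r₁ r₃ r₄ := by
  ext <;> simp only [ofRoots] <;> ring

/-- `ofRoots` is symmetric in the roots: transposition of the middle two. [folklore] -/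
theorem ofRoots_swap₂₃ (a r₁ r₂ r₃ r₄ : R) : ofRoots a r₁ r₂ r₃ r₄ = ofRoots a r₁ r₃ r₂ r₄ := by
  ext <;> simp only [ofRoots] <;> ring

/-- `ofRoots` is symmetric in the roots: transposition of the last two. [folklore] -/
theorem ofRoots_swap₃₄ (a r₁ r₂ r₃ r₄ : R) : ofRoots a r₁ r₂ r₃ r₄ = ofRoots a r₁ r₂ r₄ r₃ := by
  ext <;> simp only [ofRoots] <;> ring

/-- **`Δ = a⁶ ∏_{i<j} (rᵢ − rⱼ)²`**: the discriminant of `a ∏ (x − rᵢ y)` (the defining property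
of the discriminant of a binary quartic; here an identity between the explicit sextic formula
`BinaryQuartic.disc` and the Vieta expressions). [folklore] -/
theorem disc_ofRoots (a r₁ r₂ r₃ r₄ : R) :
    (ofRoots a r₁ r₂ r₃ r₄).disc =
      a ^ 6 * ((r₁ - r₂) * (r₁ - r₃) * (r₁ - r₄) * (r₂ - r₃) * (r₂ - r₄) * (r₃ - r₄)) ^ 2 := by
  simp only [disc, ofRoots]; ring

/-- **`∂Δ/∂e` at a form with a double root**:
`∂Δ/∂e (a(x − ry)²(x − sy)(x − ty)) = −4a⁵(s − r)³(t − r)³(s − t)²`. In particular `∂Δ/∂e ≠ 0`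
at a form of splitting type `(1²11)` with `a ≠ 0` in characteristic `≠ 2` — the reason why
`Y = {Δ = ∂Δ/∂e = 0}` only contains the more degenerate types `(1³1)`, `(1²1²)`, `(1⁴)` (and
`a·(…) = 0`), cf. Bhargava–Shankar 2015, §2.6 (the list of splitting types of `W_p^{(1)}`). [folklore] -/
theorem discDerivE_ofRoots_double (a r s t : R) :
    (ofRoots a r r s t).discDerivE = -4 * a ^ 5 * (s - r) ^ 3 * (t - r) ^ 3 * (s - t) ^ 2 := by
  simp only [discDerivE, ofRoots]; ring

/-- `I = 0` at a form with a triple root (`I(a(x − ry)³(x − ty)) = 0`). [folklore] -/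
theorem I_ofRoots_triple (a r t : R) : (ofRoots a r r r t).I = 0 := by
  simp only [I, ofRoots]; ring

/-- `J = 0` at a form with a triple root (`J(a(x − ry)³(x − ty)) = 0`). [folklore] -/
theorem J_ofRoots_triple (a r t : R) : (ofRoots a r r r t).J = 0 := by
  simp only [J, ofRoots]; ring

/-- **The square stratum.** A form `a·q(x,y)²` (`q = (x − ry)(x − sy)`) satisfies the two
equations `8a²d = b(4ac − b²)` and `64a³e = (4ac − b²)²` (for `a ≠ 0`, `2 ≠ 0` they say exactly that
`f = a(x² + βxy + γy²)²` with `β = b/2a`, `γ = (4ac − b²)/8a²`). [folklore] -/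
theorem sq_stratum_ofRoots_pair (a r s : R) :
    8 * (ofRoots a r r s s).a ^ 2 * (ofRoots a r r s s).d =
        (ofRoots a r r s s).b * (4 * (ofRoots a r r s s).a * (ofRoots a r r s s).c
          - (ofRoots a r r s s).b ^ 2) ∧
      64 * (ofRoots a r r s s).a ^ 3 * (ofRoots a r r s s).e =
        (4 * (ofRoots a r r s s).a * (ofRoots a r r s s).c - (ofRoots a r r s s).b ^ 2) ^ 2 := by
  constructor <;> simp only [ofRoots] <;> ring

end CommRing

/-! ## Over an algebraically closed field: every form with `a ≠ 0` is an `ofRoots` -/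

section Field

variable {K : Type*} [Field K]

/-- Over an algebraically closed field a binary quartic form with `a ≠ 0` factors as
`a ∏ (x − rᵢ y)`: `f = ofRoots a r₁ r₂ r₃ r₄` (the `rᵢ` are the roots of the monic quartic
`f(x,1)/a`, by Vieta). [folklore] -/
theorem exists_eq_ofRoots [IsAlgClosed K] (f : BinaryQuartic K) (ha : f.a ≠ 0) :
    ∃ a r₁ r₂ r₃ r₄ : K, a ≠ 0 ∧ f = ofRoots a r₁ r₂ r₃ r₄ := by
  -- the monic quartic `f(x,1)/a`
  have hmonic : (X ^ 4 + C (f.b / f.a) * X ^ 3 + C (f.c / f.a) * X ^ 2 + C (f.d / f.a) * X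
      + C (f.e / f.a) : K[X]).Monic := by
    monicity!
  have hdeg : (X ^ 4 + C (f.b / f.a) * X ^ 3 + C (f.c / f.a) * X ^ 2 + C (f.d / f.a) * X
      + C (f.e / f.a) : K[X]).natDegree = 4 := by
    compute_degree!
  have hsplit := IsAlgClosed.splits (X ^ 4 + C (f.b / f.a) * X ^ 3 + C (f.c / f.a) * X ^ 2
      + C (f.d / f.a) * X + C (f.e / f.a) : K[X])
  have hcard := IsAlgClosed.card_roots_eq_natDegree (k := K)
    (p := (X ^ 4 + C (f.b / f.a) * X ^ 3 + C (f.c / f.a) * X ^ 2 + C (f.d / f.a) * X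
      + C (f.e / f.a) : K[X]))
  rw [hdeg] at hcard
  obtain ⟨r₁, r₂, r₃, r₄, hroots⟩ := Multiset.card_eq_four.mp hcard
  have hprod := hsplit.eq_prod_roots_of_monic hmonic
  rw [hroots] at hprod
  simp only [Multiset.insert_eq_cons, Multiset.map_cons, Multiset.map_singleton,
    Multiset.prod_cons, Multiset.prod_singleton] at hprod
  -- compare coefficients: the difference of the two sides is a cubic, which must vanish
  have key : C (f.b / f.a + (r₁ + r₂ + r₃ + r₄)) * X ^ 3
      + C (f.c / f.a - (r₁ * r₂ + r₁ * r₃ + r₁ * r₄ + r₂ * r₃ + r₂ * r₄ + r₃ * r₄)) * X ^ 2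
      + C (f.d / f.a + (r₁ * r₂ * r₃ + r₁ * r₂ * r₄ + r₁ * r₃ * r₄ + r₂ * r₃ * r₄)) * X
      + C (f.e / f.a - r₁ * r₂ * r₃ * r₄) = (0 : K[X]) := by
    simp only [map_add, map_sub, map_mul]
    linear_combination hprod
  have h3 : f.b / f.a + (r₁ + r₂ + r₃ + r₄) = 0 := by
    have := congrArg (Polynomial.coeff · 3) key
    simp only [coeff_add, coeff_C_mul, coeff_X_pow, coeff_X, coeff_C, coeff_zero] at this
    norm_num at this
    exact this
  have h2 : f.c / f.a = r₁ * r₂ + r₁ * r₃ + r₁ * r₄ + r₂ * r₃ + r₂ * r₄ + r₃ * r₄ := by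
    have := congrArg (Polynomial.coeff · 2) key
    simp only [coeff_add, coeff_C_mul, coeff_X_pow, coeff_X, coeff_C, coeff_zero] at this
    norm_num at this
    exact sub_eq_zero.mp this
  have h1 : f.d / f.a + (r₁ * r₂ * r₃ + r₁ * r₂ * r₄ + r₁ * r₃ * r₄ + r₂ * r₃ * r₄) = 0 := by
    have := congrArg (Polynomial.coeff · 1) key
    simp only [coeff_add, coeff_C_mul, coeff_X_pow, coeff_X, coeff_C, coeff_zero] at this
    norm_num at this
    exact this
  have h0 : f.e / f.a = r₁ * r₂ * r₃ * r₄ := by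
    have := congrArg (Polynomial.coeff · 0) key
    simp only [coeff_add, coeff_C_mul, coeff_X_pow, coeff_X, coeff_C, coeff_zero] at this
    norm_num at this
    exact sub_eq_zero.mp this
  refine ⟨f.a, r₁, r₂, r₃, r₄, ha, ?_⟩
  rw [div_add' _ _ _ ha, div_eq_zero_iff] at h3 h1
  rw [div_eq_iff ha] at h2 h0
  ext
  · rfl
  · simp only [ofRoots]; linear_combination h3.resolve_right ha
  · simp only [ofRoots]; linear_combination h2
  · simp only [ofRoots]; linear_combination h1.resolve_right ha
  · simp only [ofRoots]; linear_combination h0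

/-- The structure theorem at a form already written with a repeated root: if `2 ≠ 0`, `a ≠ 0` and
`∂Δ/∂e (a(x−ry)²(x−sy)(x−ty)) = 0`, then (`discDerivE_ofRoots_double`) `s = r`, `t = r` or `s = t`,
so either the form has a triple root (`I = J = 0`) or two double roots (square stratum). [folklore] -/
theorem strata_of_discDerivE_ofRoots_double_eq_zero (h2 : (2 : K) ≠ 0) {a : K} (ha : a ≠ 0)
    (r s t : K) (hΔe : (ofRoots a r r s t).discDerivE = 0) :
    ((ofRoots a r r s t).I = 0 ∧ (ofRoots a r r s t).J = 0) ∨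
      (8 * (ofRoots a r r s t).a ^ 2 * (ofRoots a r r s t).d =
          (ofRoots a r r s t).b * (4 * (ofRoots a r r s t).a * (ofRoots a r r s t).c
            - (ofRoots a r r s t).b ^ 2) ∧
        64 * (ofRoots a r r s t).a ^ 3 * (ofRoots a r r s t).e =
          (4 * (ofRoots a r r s t).a * (ofRoots a r r s t).c - (ofRoots a r r s t).b ^ 2) ^ 2) := by
  rw [discDerivE_ofRoots_double] at hΔe
  have h4 : (-4 : K) * a ^ 5 ≠ 0 := by
    refine mul_ne_zero ?_ (pow_ne_zero _ ha)
    have : (-4 : K) = -(2 * 2) := by norm_num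
    rw [this, neg_ne_zero]
    exact mul_ne_zero h2 h2
  have hcases : s = r ∨ t = r ∨ s = t := by
    rcases mul_eq_zero.mp hΔe with h | h
    · rcases mul_eq_zero.mp h with h | h
      · rcases mul_eq_zero.mp h with h | h
        · exact absurd h h4
        · exact Or.inl (sub_eq_zero.mp (pow_eq_zero_iff (by norm_num) |>.mp h))
      · exact Or.inr (Or.inl (sub_eq_zero.mp (pow_eq_zero_iff (by norm_num) |>.mp h)))
    · exact Or.inr (Or.inr (sub_eq_zero.mp (pow_eq_zero_iff (by norm_num) |>.mp h)))
  rcases hcases with rfl | rfl | rfl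
  · exact Or.inl ⟨I_ofRoots_triple a s t, J_ofRoots_triple a s t⟩
  · rw [ofRoots_swap₃₄, ← ofRoots_swap₂₃]
    exact Or.inl ⟨I_ofRoots_triple a t s, J_ofRoots_triple a t s⟩
  · exact Or.inr (sq_stratum_ofRoots_pair a r s)

/-- **Structure of `Y = {Δ = ∂Δ/∂e = 0}` off `a = 0`** (over an algebraically closed field of
characteristic `≠ 2`). If `a(f) ≠ 0`, `Δ(f) = 0` and `∂Δ/∂e(f) = 0`, then either `I(f) = J(f) = 0`
(`f` has a root of multiplicity `≥ 3`) or `8a²d = b(4ac − b²)` and `64a³e = (4ac − b²)²` (`f = a·q²`).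
Proof: write `f = a∏(x − rᵢy)`; `Δ = a⁶∏(rᵢ − rⱼ)² = 0` forces a repeated root, and at a form of
type `(1²11)` one has `∂Δ/∂e = −4a⁵(s−r)³(t−r)³(s−t)² ≠ 0`. This is the content of "`Y` is the
codimension 2 subscheme of `V ≅ 𝔸⁵` defined by the vanishing of `Δ` and `∂Δ/∂e`" in
Bhargava–Shankar 2015, §2.6 (after Thm 2.18), in the explicit form used for point counting in the
companion file. [cite: BhargavaShankarAnnals2015, §2.6, paragraph after Thm 2.18 (published numbering)] -/
theorem strata_of_disc_eq_zero_of_discDerivE_eq_zero [IsAlgClosed K] (h2 : (2 : K) ≠ 0)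
    (f : BinaryQuartic K) (ha : f.a ≠ 0) (hΔ : f.disc = 0) (hΔe : f.discDerivE = 0) :
    (f.I = 0 ∧ f.J = 0) ∨
      (8 * f.a ^ 2 * f.d = f.b * (4 * f.a * f.c - f.b ^ 2) ∧
        64 * f.a ^ 3 * f.e = (4 * f.a * f.c - f.b ^ 2) ^ 2) := by
  obtain ⟨a, r₁, r₂, r₃, r₄, ha, rfl⟩ := exists_eq_ofRoots f ha
  rw [disc_ofRoots] at hΔ
  have hV : (r₁ - r₂) * (r₁ - r₃) * (r₁ - r₄) * (r₂ - r₃) * (r₂ - r₄) * (r₃ - r₄) = 0 := by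
    rcases mul_eq_zero.mp hΔ with h | h
    · exact absurd (pow_eq_zero_iff (by norm_num) |>.mp h) ha
    · exact pow_eq_zero_iff (by norm_num) |>.mp h
  simp only [mul_eq_zero, sub_eq_zero] at hV
  rcases hV with ((((h | h) | h) | h) | h) | h
  · subst h
    exact strata_of_discDerivE_ofRoots_double_eq_zero h2 ha r₁ r₃ r₄ hΔe
  · subst h
    rw [ofRoots_swap₂₃] at hΔe ⊢
    exact strata_of_discDerivE_ofRoots_double_eq_zero h2 ha r₁ r₂ r₄ hΔe
  · subst h
    rw [ofRoots_swap₃₄, ofRoots_swap₂₃] at hΔe ⊢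
    exact strata_of_discDerivE_ofRoots_double_eq_zero h2 ha r₁ r₂ r₃ hΔe
  · subst h
    rw [ofRoots_swap₁₂, ofRoots_swap₂₃] at hΔe ⊢
    exact strata_of_discDerivE_ofRoots_double_eq_zero h2 ha r₂ r₁ r₄ hΔe
  · subst h
    rw [ofRoots_swap₃₄, ofRoots_swap₁₂, ofRoots_swap₂₃] at hΔe ⊢
    exact strata_of_discDerivE_ofRoots_double_eq_zero h2 ha r₂ r₁ r₃ hΔe
  · subst h
    rw [ofRoots_swap₂₃, ofRoots_swap₁₂, ofRoots_swap₃₄, ofRoots_swap₂₃] at hΔe ⊢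
    exact strata_of_discDerivE_ofRoots_double_eq_zero h2 ha r₃ r₁ r₂ hΔe

end Field

/-! ## Finiteness of `V_R` for finite `R` -/

section Fintype

variable {R : Type*}

/-- `V_R = R⁵` is finite when `R` is (through the coefficient vector `equivFin5`). [folklore] -/
instance instFintype [Fintype R] : Fintype (BinaryQuartic R) :=
  Fintype.ofEquiv (Fin 5 → R) equivFin5.symm

/-- `#V_R = (#R)⁵`. [folklore] -/
theorem card_eq [Fintype R] : Fintype.card (BinaryQuartic R) = Fintype.card R ^ 5 := by
  rw [Fintype.card_congr (equivFin5 (R := R)), Fintype.card_fun, Fintype.card_fin]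

end Fintype

end BinaryQuartic

end Literature.NumberTheory.EllipticCurves

end
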